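import Summits.BirchSwinnertonDyer.BirchSwinnertonDyer.Theorems.GenusKolyvaginAtTwoMinimalTwinBSDTwoTwinHalvingDescent
import Summits.BirchSwinnertonDyer.BirchSwinnertonDyer.Theorems.GenusKolyvaginAtTwoMinimalTwinBSDTwoOddCutOfTranspositionWitness
import HarnessLib

/-!
# Route `GenusKolyvaginAtTwo`, crux U₂ `MinimalTwinBSDTwo` (stmt-BirchSwinnertonDyer-22985), LINE 23 «twin_swap» — DEPTH ONE ON THE ODD HABITAT CUT
# NEEDS NO KOLYVAGIN-CONJECTURE INPUT AT A DOOR-CLOSED FRAME: U₂ ⟸ WALL row 1 + PRINT + Q2 + «one odd Heegner budget frame of exact depth 1 whose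
# twin has a nonzero `2^M`-Selmer class»

Seat `bsd-line-gk2-p2` g32 (PROVER seat 2/3, cell `bsd-f1-sign2`, LINE 23 holder), `--supports stmt-BirchSwinnertonDyer-22985 --as helper`.
THEOREMS ONLY (no definition, no named fact, no `sorry`).  BSD is NOT proved by any of this; U₂ is NOT proved; nothing is closed.

WHAT.  Sequel of this seat's swapped halving descent B2Q♭⁻± (`…MinimalTwinBSDTwoTwinHalvingDescent`,
`exists_transpositionWitness_of_two_pow_pred_smul_selmer_twist_ne_zero_signFree`): at exact depth `M₀ = 1` its hypothesis `2^{M₀−1} • s₀ ≠ 0` is just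
`s₀ ≠ 0`, so ONE nonzero class of `Sel_(2^M)(W^{(d_K)}/ℚ)` (`M ≥ 2`) — available at every DOOR-CLOSED frame (`Ш(W^{(d_K)}/ℚ)[2] ≠ 0`) — PRODUCES the
transposition-deep prime witness that LINE 23's WITNESS^± stub asks for.  With this seat's p811686 (`bsdp_onOddCut_of_transpositionWitness_of_facts`):
* §1 `exists_transpositionWitness_of_depth_one_of_selmer_twist_ne_zero` — the witness clause of WITNESS^± at depth one from one nonzero twin class;
* §2 `bsdp_onOddCut_of_depthOne_of_selmer_twist_ne_zero_of_facts` — `BSD₂(Wd) → BSD₂(W)` on the odd habitat cut at a budget frame of exact depth one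
  with a nonzero twin class, modulo Q2 + GZ + GZK + modularity + Milne — NO witness hypothesis;
* §3 `minimalTwinBSDTwo_onOddCut_of_wall_of_depthOneFrameSupply_of_facts` — **U₂ on the WHOLE odd habitat cut ⟸ WALL row 1 + PRINT + Q2 + FRAME¹**
  (per `W`: one odd Heegner frame `≠ ℚ(√−3)` inside the genus budget, an odd-`c` datum, `P(1)` non-torsion with `2 ∣ P(1)`, `4 ∤ P(1)` in `W(K[1])`,
  and a nonzero class in `Sel_(2^M)(W^{(d_K)}/ℚ)` for some `M ≥ 2`).  This is the `ε = −1` mirror of the route's CLOSED depth-one item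
  `K4NegDepthOneOnCut` (33814), both signs of `Δ`: together with p812083 (depth `0` = the frame itself) the Kolyvagin leaf of LINE 23 is now confined to
  frames of depth `≥ 2` or depth-one frames with `2`-Selmer-TRIVIAL twin.

HONEST FRAMING.  CONDITIONAL on the displayed hypotheses (Q2 = item 24880, PRINT facts, the twin's `BSD₂` / WALL row 1); FRAME¹ is an OPEN analytic-
plus-Selmer statement (existence of such a frame); nothing beyond print is claimed as a theorem about BSD; BSD is NOT proved; U₂ is NOT proved.

References: [Kolyvagin1989Izv] Thm. B_l, §3; [McCallumLMS1991] §5 Lemma 5.3, Thm. 5.4; [Kolyvagin1991MathAnn] Thm. 1; [GrossZagier1986] V.§2 (2.2).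
-/

set_option autoImplicit false
set_option linter.dupNamespace false -- `Summit.<P>.<Sub>` repeats `BirchSwinnertonDyer` (D-0017)

noncomputable section

open scoped Classical

namespace Summit.BirchSwinnertonDyer.BirchSwinnertonDyer.Theorems.GenusExact.TwinSwap.TwinAnnihilation

open Literature.NumberTheory.EllipticCurves Literature.NumberTheory.GaloisRepresentations WeierstrassCurve NumberField
  IsDedekindDomain Field AddSubgroup Literature.NumberTheory.EllipticCurves.ModularForms
open Summit.BirchSwinnertonDyer.Rank1Residual
open Summit.BirchSwinnertonDyer.BirchSwinnertonDyer.Theses.GenusKolyvaginAtTwo (KolyvaginRelationAtTwo)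

/-! ## §1 The witness clause at depth one from one nonzero twin class -/

/-- **DEPTH ONE: one nonzero class of `Sel_(2^M)(W^{(d_K)}/ℚ)` (`M ≥ 2`) gives LINE 23's transposition-deep witness clause**, on the habitat with
`w(W) = −1`, `2 ∣ P(1)`-depth exactly one (`4 ∤ P(1)` in `W(K[1])`), either sign of `Δ`, modulo Q2 — B2Q♭⁻± at `M₀ = 1` (its hypothesis
`2^{M₀−1} • s₀ ≠ 0` is `s₀ ≠ 0`), repackaged as `∃ n d, Squarefree n ∧ (∀ ℓ ∣ n, Zhang–Kolyvagin ∧ index ≥ 2 ∧ a Frobenius moving a point of W[2]) ∧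
P(n) ∉ 2W(K[n])` with `n = ℓ` prime.  CONDITIONAL on Q2; BSD is NOT proved. [cite: Kolyvagin1989Izv, Thm. B_l, §3] [cite: McCallumLMS1991, §5 Lemma 5.3, Thm. 5.4] -/
theorem exists_transpositionWitness_of_depth_one_of_selmer_twist_ne_zero (hQ2 : KolyvaginRelationAtTwo)
    (W : WeierstrassCurve ℚ) [W.IsElliptic] [W.IsGloballyMinimal] [NeZero (W.conductorNorm ℤ)] (hcm : ¬ W.HasCM)
    (hT : Odd W.tamagawaProduct) (v : HeightOneSpectrum (𝓞 ℚ)) (h2v : ((2 : ℕ) : 𝓞 ℚ) ∉ v.asIdeal)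
    (hNv : ((W.conductorNorm ℤ : ℕ) : 𝓞 ℚ) ∈ v.asIdeal) (hmult : W.HasMultiplicativeReductionAt v)
    (K : Type) [Field K] [NumberField K] (hIQ : IsImaginaryQuadratic K) (hodd : Odd (NumberField.discr K))
    (h3 : NumberField.discr K ≠ -3) (hHe : SatisfiesHeegnerHypothesis (W.conductorNorm ℤ) K)
    (hρ : ∀ n : ℕ, 0 < n → W.HasSurjectiveModNGaloisRep ((2 : ℤ) ^ n))
    (Dt : ModularParametrizationData W (W.conductorNorm ℤ)) (β : ℤ) (ι : K →+* ℂ) (d₁ : KolyvaginHeegnerData Dt β ι 1)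
    (hndiv : ¬ ∃ Q : (W.baseChange (ringClassField K ι 1)).toAffine.Point, ((2 ^ (1 + 1) : ℕ) : ℤ) • Q = d₁.derivedPoint)
    (hw : W.rootNumber = -1)
    [(W.quadraticTwist ((NumberField.discr K : ℤ) : ℚ)).IsElliptic]
    (M : ℕ) (hM : 2 ≤ M) (s₀ : galH1Torsion (W.quadraticTwist ((NumberField.discr K : ℤ) : ℚ)) ((2 ^ M : ℕ) : ℤ))
    (hs₀ : s₀ ∈ selmerGroup (W.quadraticTwist ((NumberField.discr K : ℤ) : ℚ)) ((2 ^ M : ℕ) : ℤ)) (hs0 : s₀ ≠ 0) :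
    ∃ (n : ℕ) (d : KolyvaginHeegnerData Dt β ι n), Squarefree n ∧
      (∀ ℓ ∈ n.primeFactors, Zhang2014.IsKolyvaginPrime (W.conductorNorm ℤ) W K 2 ℓ ∧ 2 ≤ Zhang2014.kolyvaginIndex W 2 ℓ ∧
        ∃ (v : HeightOneSpectrum (𝓞 ℚ)) (𝔓 : Ideal (absIntegers (𝓞 ℚ) ℚ)) (h : absoluteGaloisGroup ℚ),
          ((ℓ : ℕ) : 𝓞 ℚ) ∈ v.asIdeal ∧ 𝔓 ∈ v.primesAbove ∧ IsArithFrobAt (𝓞 ℚ) h 𝔓 ∧ ∃ u : W.geomTorsion ((2 : ℕ) : ℤ), h • u ≠ u) ∧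
      ¬ ∃ Q : (W.baseChange (ringClassField K ι n)).toAffine.Point, (2 : ℤ) • Q = d.derivedPoint := by
  obtain ⟨hsq1, hsq2⟩ := kolyvaginExclusions_of_odd_of_satisfiesHeegnerHypothesis W hIQ hodd hHe
  have hne : ((2 ^ (1 - 1) : ℕ) : ℤ) • s₀ ≠ 0 := by
    rwa [show ((2 ^ (1 - 1) : ℕ) : ℤ) = 1 from by norm_num, one_zsmul]
  obtain ⟨ℓ, d, hkol, hidx, ⟨v', 𝔓, h, c₀, hℓv', h𝔓, hfr, -, -, hu, -⟩, -, -, hPn⟩ :=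
    exists_transpositionWitness_of_two_pow_pred_smul_selmer_twist_ne_zero_signFree hQ2 W hcm hT v h2v hNv hmult K hIQ hodd h3 hHe hsq1 hsq2 hρ
      Dt β ι d₁ 1 hndiv hw M (by omega) s₀ hs₀ hne
  have hℓp : ℓ.Prime := hkol.1
  refine ⟨1 * ℓ, d, by rw [one_mul]; exact hℓp.squarefree, fun q hq ↦ ?_, hPn⟩
  rw [one_mul, hℓp.primeFactors, Finset.mem_singleton] at hq
  subst hq
  exact ⟨hkol, le_trans (by omega) hidx, v', 𝔓, h, hℓv', h𝔓, hfr, hu⟩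

/-! ## §2 `BSD₂(Wd) → BSD₂(W)` at a depth-one frame with a nonzero twin class -/

/-- **`BSD₂(Wd) → BSD₂(W)` on the odd habitat cut at a budget frame of EXACT DEPTH ONE carrying a nonzero `2^M`-Selmer class of the twin (`M ≥ 2`)**
— NO witness hypothesis: §1 manufactures the transposition-deep prime, then p811686 §4.  Modulo Q2 + GZ + GZK + modularity + Milne; `w(W) = −1` from
`r_an(W) = 1`.  CONDITIONAL; closes nothing; BSD is NOT proved. [cite: Kolyvagin1989Izv, Thm. B_l] [cite: McCallumLMS1991, §5 Thm. 5.4]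
[cite: GrossZagier1986, V.§2 (2.2)] -/
theorem bsdp_onOddCut_of_depthOne_of_selmer_twist_ne_zero_of_facts (hQ2 : KolyvaginRelationAtTwo)
    (hGZ : ∀ (N : ℕ) [NeZero N] (W : WeierstrassCurve ℚ) (K : Type) [Field K] [NumberField K], gross_zagier N W K)
    (hGZK : rank_eq_analyticRank_of_analyticRank_le_one) (hmod : hasEntireLFunction_rat)
    (hMilneC : Milne1972.bsdQuotient_baseChange_quadratic_anyModel)
    (W : WeierstrassCurve ℚ) [W.IsElliptic] [W.IsGloballyMinimal] [NeZero (W.conductorNorm ℤ)] (hcm : ¬ W.HasCM)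
    (hr : W.analyticRank = 1) (hSel : Nat.card (W.selmerGroup 2) = 2)
    (hT : Odd W.tamagawaProduct) (v : HeightOneSpectrum (𝓞 ℚ)) (h2v : ((2 : ℕ) : 𝓞 ℚ) ∉ v.asIdeal)
    (hNv : ((W.conductorNorm ℤ : ℕ) : 𝓞 ℚ) ∈ v.asIdeal) (hmult : W.HasMultiplicativeReductionAt v)
    (hρ : ∀ n : ℕ, 0 < n → W.HasSurjectiveModNGaloisRep ((2 : ℤ) ^ n))
    (K : Type) [Field K] [NumberField K] (hK : IsImaginaryQuadratic K) (hodd : Odd (NumberField.discr K))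
    (h3 : NumberField.discr K ≠ -3) (hH : SatisfiesHeegnerHypothesis (W.conductorNorm ℤ) K)
    (Dt : ModularParametrizationData W (W.conductorNorm ℤ)) (hc : Odd Dt.c) (β : ℤ) (ι : K →+* ℂ) (d₁ : KolyvaginHeegnerData Dt β ι 1)
    (hy : ¬ IsOfFinAddOrder d₁.derivedPoint)
    (hdiv : ∃ Q : (W.baseChange (ringClassField K ι 1)).toAffine.Point, ((2 ^ 1 : ℕ) : ℤ) • Q = d₁.derivedPoint)
    (hndiv : ¬ ∃ Q : (W.baseChange (ringClassField K ι 1)).toAffine.Point, ((2 ^ (1 + 1) : ℕ) : ℤ) • Q = d₁.derivedPoint)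
    (Wd : WeierstrassCurve ℚ) [Wd.IsElliptic] [Wd.IsGloballyMinimal]
    (hWd : ∃ C : VariableChange ℚ, C • W.quadraticTwist (NumberField.discr K : ℚ) = Wd)
    (hbudget : (W.Δ < 0 ∧ padicValNat 2 Wd.tamagawaProduct ≤ 1) ∨ padicValNat 2 Wd.tamagawaProduct = 0) (hBSDd : BSDp Wd 2)
    [(W.quadraticTwist ((NumberField.discr K : ℤ) : ℚ)).IsElliptic]
    (M : ℕ) (hM : 2 ≤ M) (s₀ : galH1Torsion (W.quadraticTwist ((NumberField.discr K : ℤ) : ℚ)) ((2 ^ M : ℕ) : ℤ))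
    (hs₀ : s₀ ∈ selmerGroup (W.quadraticTwist ((NumberField.discr K : ℤ) : ℚ)) ((2 ^ M : ℕ) : ℤ)) (hs0 : s₀ ≠ 0) :
    BSDp W 2 := by
  have hw : W.rootNumber = -1 := TwinSwapBit.rootNumber_eq_neg_one_of_analyticRank_eq_one W hr Dt
  obtain ⟨n, d, hn, hdeep, hPn⟩ := exists_transpositionWitness_of_depth_one_of_selmer_twist_ne_zero hQ2 W hcm hT v h2v hNv hmult K hK hodd h3 hH hρ
    Dt β ι d₁ hndiv hw M hM s₀ hs₀ hs0
  exact bsdp_onOddCut_of_transpositionWitness_of_facts hQ2 hGZ hGZK hmod hMilneC W hcm hr hSel hT v h2v hNv hmult hρ K hK hodd h3 hH Dt hc β ι d₁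
    hy 1 hdiv hndiv Wd hWd hbudget hBSDd n d hn hdeep hPn

/-! ## §3 U₂ on the cut from WALL row 1 + PRINT + Q2 + a depth-one frame supply -/

/-- **U₂ ON THE WHOLE ODD HABITAT CUT ⟸ WALL row 1 + PRINT + Q2 + FRAME¹-SUPPLY** — NO Kolyvagin-conjecture input.  Displayed hypotheses: S1′ (`BSD₂`
for non-CM globally minimal curves of analytic rank `0`); the four PRINT facts; Q2; and FRAME¹: for every `W` on the cut (non-CM, `r_an = 1`, `#Sel₂ = 2`,
`C(W)` odd, `ρ_{W,2^∞}` onto, an odd multiplicative prime) ONE odd Heegner frame `K ≠ ℚ(√−3)`, an odd-`c` datum, a conductor-`1` datum whose `P(1)` has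
infinite order and EXACT DEPTH ONE (`2 ∣ P(1)`, `4 ∤ P(1)` in `W(K[1])`), a globally minimal twin model inside the budget, and a NONZERO class in
`Sel_(2^M)(W^{(d_K)}/ℚ)` for some `M ≥ 2` (a door-closed frame).  Then `BSD₂(W)` on the cut (§2; the twin is non-CM of analytic rank `0`, so S1′ pays
`BSD₂(Wd)`).  The `ε = −1` mirror of `K4NegDepthOneOnCut`, both signs of `Δ`.  FRAME¹ is OPEN; CONDITIONAL; closes nothing; BSD is NOT proved.
[cite: Kolyvagin1989Izv, Thm. A, Thm. B_l] [cite: McCallumLMS1991, §5] [cite: GrossZagier1986, V.§2 (2.2)] -/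
theorem minimalTwinBSDTwo_onOddCut_of_wall_of_depthOneFrameSupply_of_facts (hQ2 : KolyvaginRelationAtTwo)
    (hGZ : ∀ (N : ℕ) [NeZero N] (W : WeierstrassCurve ℚ) (K : Type) [Field K] [NumberField K], gross_zagier N W K)
    (hGZK : rank_eq_analyticRank_of_analyticRank_le_one) (hmod : hasEntireLFunction_rat)
    (hMilneC : Milne1972.bsdQuotient_baseChange_quadratic_anyModel)
    (hS1 : ∀ (W : WeierstrassCurve ℚ) [W.IsElliptic] [W.IsGloballyMinimal], ¬ W.HasCM → W.analyticRank = 0 → BSDp W 2)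
    (hSupply1 : ∀ (W : WeierstrassCurve ℚ) [W.IsElliptic] [W.IsGloballyMinimal] [NeZero (W.conductorNorm ℤ)],
      ¬ W.HasCM → W.analyticRank = 1 → Nat.card (W.selmerGroup 2) = 2 → Odd W.tamagawaProduct →
      (∀ n : ℕ, 0 < n → W.HasSurjectiveModNGaloisRep ((2 : ℤ) ^ n)) →
      (∃ v : HeightOneSpectrum (𝓞 ℚ), ((2 : ℕ) : 𝓞 ℚ) ∉ v.asIdeal ∧ ((W.conductorNorm ℤ : ℕ) : 𝓞 ℚ) ∈ v.asIdeal ∧ W.HasMultiplicativeReductionAt v) →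
      ∃ (K : Type) (_ : Field K) (_ : NumberField K), IsImaginaryQuadratic K ∧ Odd (NumberField.discr K) ∧ NumberField.discr K ≠ -3 ∧
        SatisfiesHeegnerHypothesis (W.conductorNorm ℤ) K ∧
        ∃ (Dt : ModularParametrizationData W (W.conductorNorm ℤ)) (β : ℤ) (ι : K →+* ℂ) (d₁ : KolyvaginHeegnerData Dt β ι 1),
          Odd Dt.c ∧ ¬ IsOfFinAddOrder d₁.derivedPoint ∧
          (∃ Q : (W.baseChange (ringClassField K ι 1)).toAffine.Point, ((2 ^ 1 : ℕ) : ℤ) • Q = d₁.derivedPoint) ∧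
          (¬ ∃ Q : (W.baseChange (ringClassField K ι 1)).toAffine.Point, ((2 ^ (1 + 1) : ℕ) : ℤ) • Q = d₁.derivedPoint) ∧
          (∃ (Wd : WeierstrassCurve ℚ) (_ : Wd.IsElliptic) (_ : Wd.IsGloballyMinimal),
            (∃ C : VariableChange ℚ, C • W.quadraticTwist (NumberField.discr K : ℚ) = Wd) ∧
              ((W.Δ < 0 ∧ padicValNat 2 Wd.tamagawaProduct ≤ 1) ∨ padicValNat 2 Wd.tamagawaProduct = 0)) ∧
          ∃ (_ : (W.quadraticTwist ((NumberField.discr K : ℤ) : ℚ)).IsElliptic) (M : ℕ)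
            (s₀ : galH1Torsion (W.quadraticTwist ((NumberField.discr K : ℤ) : ℚ)) ((2 ^ M : ℕ) : ℤ)),
            2 ≤ M ∧ s₀ ∈ selmerGroup (W.quadraticTwist ((NumberField.discr K : ℤ) : ℚ)) ((2 ^ M : ℕ) : ℤ) ∧ s₀ ≠ 0) :
    ∀ (W : WeierstrassCurve ℚ) [W.IsElliptic] [W.IsGloballyMinimal] [NeZero (W.conductorNorm ℤ)],
      ¬ W.HasCM → W.analyticRank = 1 → Nat.card (W.selmerGroup 2) = 2 → Odd W.tamagawaProduct →
      (∀ n : ℕ, 0 < n → W.HasSurjectiveModNGaloisRep ((2 : ℤ) ^ n)) →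
      (∃ v : HeightOneSpectrum (𝓞 ℚ), ((2 : ℕ) : 𝓞 ℚ) ∉ v.asIdeal ∧ ((W.conductorNorm ℤ : ℕ) : 𝓞 ℚ) ∈ v.asIdeal ∧ W.HasMultiplicativeReductionAt v) →
      BSDp W 2 := by
  intro W _ _ _ hcm hr hSel hT hρ hv
  obtain ⟨K, iF, iN, hK, hodd, h3, hH, Dt, β, ι, d₁, hc, hy, hdiv, hndiv, ⟨Wd, iE, iM, ⟨Cd, hCd⟩, hbudget⟩, iT, M, s₀, hM, hs₀, hs0⟩ :=
    hSupply1 W hcm hr hSel hT hρ hv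
  obtain ⟨v, h2v, hNv, hmult⟩ := hv
  -- the twin model is non-CM (same `j`) of analytic rank `0` (Gross–Zagier), so `BSD₂(Wd)` by S1′
  have hD0 : (NumberField.discr K : ℚ) ≠ 0 := by exact_mod_cast NumberField.discr_ne_zero K
  obtain ⟨Ph, hPh, hPhmap⟩ := AdditiveKoly.exists_isHeegnerPoint_map_eq_derivedPoint_one (W := W) (K := K) (Dt := Dt) (β := β)
    (ι := ι) hK hH d₁
  have hPinf : ¬ IsOfFinAddOrder Ph := by
    intro hfin
    apply hy
    rw [← hPhmap]
    exact (WeierstrassCurve.Affine.Point.map (W' := W) (algebraMap K (ringClassField K ι 1)).toRatAlgHom).isOfFinAddOrder hfin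
  have hrT : (W.quadraticTwist (NumberField.discr K : ℚ)).analyticRank = 0 :=
    analyticRank_twist_eq_zero_of_rankOne W K (hGZ _ W K) hmod hK hH hr hPh hPinf
  subst hCd
  have hcmd : ¬ (Cd • W.quadraticTwist (NumberField.discr K : ℚ)).HasCM := by
    rw [hasCM_iff_of_j_eq (((W.quadraticTwist (NumberField.discr K : ℚ)).variableChange_j Cd).trans (W.j_quadraticTwist hD0))]
    exact hcm
  have hrd : (Cd • W.quadraticTwist (NumberField.discr K : ℚ)).analyticRank = 0 := by
    rw [analyticRank_smul]
    exact hrT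
  exact bsdp_onOddCut_of_depthOne_of_selmer_twist_ne_zero_of_facts hQ2 hGZ hGZK hmod hMilneC W hcm hr hSel hT v h2v hNv hmult hρ K hK hodd h3 hH Dt
    hc β ι d₁ hy hdiv hndiv (Cd • W.quadraticTwist (NumberField.discr K : ℚ)) ⟨Cd, rfl⟩ hbudget (hS1 _ hcmd hrd) M hM s₀ hs₀ hs0

end Summit.BirchSwinnertonDyer.BirchSwinnertonDyer.Theorems.GenusExact.TwinSwap.TwinAnnihilation

end
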